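import Summits.BirchSwinnertonDyer.Rank1Residual.Additive.ChiBranchInputOdd
import Summits.BirchSwinnertonDyer.Rank1Residual.Additive.SemistableTwistAnalytic
import HarnessLib

/-!
# The additive twist at `p ≡ 3 (mod 4)`: `L(E,1) = ±ϖ⁻·(∑ (a/p)[a/p]⁻_{f♭})·Ω_E/(|u|·c_∞)` from the ODD Birch formula and Pal's `d < 0` period relation (cell `b2b-bsdres`, seat additive-p4, line V9)

HONEST FRAMING (cell `b2b-bsdres`, run/shared/lean/b2b/bsd-rank1-residual/, verbatim in every
file): the goal of the cell is to DELETE the COMBINATION-SHAPED residual classes of the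
Birch–Swinnerton-Dyer formula for ALL analytic-rank `≤ 1` elliptic curves over `ℚ` — "full BSD
formula for every rank `≤ 1` curve in class `C`" assembled STRICTLY from published theorems — so
that the rank-`≤ 1` remainder becomes exactly the CONSTRUCTION-SHAPED classes, which are TYPED
(missing-input `Prop`s), NOT attempted. This is not "finishing BSD". The additive sub-cell (seats
additive-p1…p4) is a RESEARCH ROUTE on the construction-shaped classes X3/X4; no claim beyond the
stated classes; the label of X3 is UNCHANGED (its one non-published input is TYPED).

Theorems only (no definition, no named fact at all beyond modularity `hmod`). Odd twin of
`SemistableTwistAnalytic.lean` (p203305), built on the literature seat's `PAdicLFunctionMinus.lean`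
(the minus symbol `[r]⁻_f`, the ODD Birch formula `ratMinusTwistedSymbolSum_mul_minusPeriod_mul_I`,
PROVED) and `ImaginaryPeriod.lean` (`|Ω⁻(W)| = imaginaryPeriodRat`, Pal 2012 Thm. 3.2 for `d < 0`
PROVED as `realPeriodRat_mul_sqrt_of_twist_of_neg` with the scaling `|u(C)|` explicit). Setting:
`p ≡ 3 (mod 4)` (so `p* = −p`, `χ_p = (·/p)` ODD), `E = W = C • V^{(−p)}` additive at `p`, `V = E♭`
with newform `f`, `ϖ⁻ ∈ ℚ` with `ϖ⁻ · |Ω⁻(V)| = Ω⁻_f`.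

* `intCast_LFunction_eq_jacobiChar_mul_cuspCoeff_of_neg` — [F] `aₙ(E) = (n/p)·aₙ(f)` for all `n`;
* `entireLFunction_one_eq_of_twist_neg` — **`L(E, 1) = ε · ϖ⁻ · (∑_{a mod p} (a/p)[a/p]⁻_f) · Ω_E /
  (|u(C)| · c_∞(E))`, `ε = ±1`**: odd Birch `(∑ …)·Ω⁻_f·i = τ(χ_p)·L(E,1)`, `τ(χ_p)² = −p` (Mathlib
  `gaussSum_sq`), Pal `Ω_E·√p = |u(C)|·c_∞(E)·|Ω⁻(V)|`; `c_∞(E) ∈ {1, 2}` the number of real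
  components (`numRealComponents`); `u(C)` the scaling of the change of variables from the twisted
  model `V^{(−p)}` to the globally minimal `W` (a `p`-adic unit, since `V^{(−p)}` is already
  `p`-minimal for `V` semistable at `p` — Pal's `u_p = 1`; used as the hypothesis `ord_p u(C) = 0`
  downstream).
Consumer: `Additive/X3RankZeroSemistableTwistOdd.lean`.

References: Pal 2012 [Pal2012] Thm. 3.2, Prop. 2.5; Mazur–Tate–Teitelbaum 1986
[MazurTateTeitelbaum1986Invent] §I.8 (8.6); Cremona, *Algorithms* §2.8; Silverman *AEC* X.2.
-/

noncomputable section

open scoped Classical MatrixGroups ModularForm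

open CongruenceSubgroup WeierstrassCurve Literature.NumberTheory.EllipticCurves
  Literature.NumberTheory.EllipticCurves.ModularForms
  Literature.NumberTheory.EllipticCurves.Rank1Residual

namespace Summit.BirchSwinnertonDyer.Rank1Residual.Additive

/-! ## The analytic side at `p ≡ 3 (mod 4)` -/

section AnalyticOdd

open Literature.NumberTheory.QuadraticFields Rat.HeightOneSpectrum

variable (p : ℕ) [hp : Fact p.Prime]

omit hp in
/-- `p ≡ 3 (mod 4)` ⇒ `(−1)^{⌊p/2⌋} = −1`, i.e. `p* = −p`. -/
theorem neg_one_pow_half_eq_neg_one_of_mod_four_eq_three (hp4 : p % 4 = 3) :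
    (-1 : ℤ) ^ (p / 2) = -1 := by
  have h : Odd (p / 2) := ⟨p / 4, by omega⟩
  exact h.neg_one_pow

/-- For `p ≡ 3 (mod 4)` the Legendre character is ODD: `(−1/p) = −1` (tree
`jacobiChar_neg_one_of_mod_four_eq_three`). -/
theorem jacobiChar_odd_of_mod_four_eq_three (hp4 : p % 4 = 3) :
    haveI : NeZero p := ⟨hp.out.ne_zero⟩
    (jacobiChar p).Odd := by
  haveI : NeZero p := ⟨hp.out.ne_zero⟩
  exact jacobiChar_neg_one_of_mod_four_eq_three hp4

/-- The rational `∑ (a/p)[a/p]⁻_f`, cast to `ℂ`, is the tree's minus twisted symbol sum at the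
Legendre character. -/
theorem cast_legendreMinusSymbolSum_eq_ratMinusTwistedSymbolSum {N : ℕ} (f : CuspForm (Gamma0 N) 2) :
    haveI : NeZero p := ⟨hp.out.ne_zero⟩
    ((legendreMinusSymbolSum f p : ℚ) : ℂ) = ratMinusTwistedSymbolSum f (jacobiChar p) := by
  haveI : NeZero p := ⟨hp.out.ne_zero⟩
  rw [legendreMinusSymbolSum_def, ratMinusTwistedSymbolSum]
  push_cast
  refine Finset.sum_congr rfl fun a _ ↦ ?_
  rw [jacobiChar_apply, ← jacobiSym.legendreSym.to_jacobiSym]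

/-- **[F] at `p ≡ 3 (mod 4)`, coefficientwise: `aₙ(E) = (n/p) · aₙ(f♭)`** for the additive curve
`E = W ≅ V ⊗ χ_{p*}`, `p* = −p`, and the newform `f = f♭` of `V` (the tree's
`LFunction_quadraticTwist_pStar_apply` for `p ∤ n`; `aₙ(E) = 0` for `p ∣ n`, `W` additive at `p`). -/
theorem intCast_LFunction_eq_jacobiChar_mul_cuspCoeff_of_neg (hp4 : p % 4 = 3)
    (V W : WeierstrassCurve ℚ) [V.IsElliptic] [W.IsElliptic]
    (hVW : ∃ C : VariableChange ℚ, C • V.quadraticTwist (-(p : ℚ)) = W) (hadd : Addv W p)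
    {N : ℕ} [NeZero N] {f : CuspForm (Gamma0 N) 2} (hf : IsNewformOf V f) (n : ℕ) :
    haveI : NeZero p := ⟨hp.out.ne_zero⟩
    ((W.LFunction n : ℤ) : ℂ) = jacobiChar p n * cuspCoeff f n := by
  haveI : NeZero p := ⟨hp.out.ne_zero⟩
  have hp2 : p ≠ 2 := by omega
  obtain ⟨C, hC⟩ := hVW
  rw [jacobiChar_natCast, ← jacobiSym.legendreSym.to_jacobiSym]
  by_cases hpn : p ∣ n
  · have hv := primesEquiv_symm_apply_coe p
    have h0 := W.LFunction_apply_eq_zero_of_hasAdditiveReductionAt hv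
      (hasAdditiveReductionAt_of_addv W p hadd) hpn
    have hleg : legendreSym p (n : ℤ) = 0 :=
      (legendreSym.eq_zero_iff p (n : ℤ)).mpr (by exact_mod_cast (ZMod.natCast_eq_zero_iff n p).mpr hpn)
    rw [h0, hleg]
    push_cast
    ring
  · have hpstar : (((-1 : ℤ) ^ (p / 2) * p : ℤ) : ℚ) = -(p : ℚ) := by
      rw [neg_one_pow_half_eq_neg_one_of_mod_four_eq_three p hp4]
      push_cast
      ring
    have key := V.LFunction_quadraticTwist_pStar_apply hp2 hpn
    rw [hpstar] at key
    haveI := V.isElliptic_quadraticTwist (d := -(p : ℚ))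
      (neg_ne_zero.mpr (by exact_mod_cast hp.out.ne_zero))
    rw [← hC, LFunction_smul, key, hf.2 n]
    push_cast
    ring

/-- **[E⁻] + [F] + odd Birch at `p ≡ 3 (mod 4)`:
`L(E, 1) = ε · ϖ⁻ · (∑_{a mod p} (a/p)[a/p]⁻_f) · Ω_E / (|u| · c_∞(E))` with `ε = ±1`.** Here
`E = W = C • V^{(−p)}` is additive at `p`, `V = E♭` has newform `f` and `ϖ⁻ · |Ω⁻(V)| = Ω⁻_f`,
`u = u(C)`, `c_∞(E) ∈ {1, 2}` the number of real components. The odd Birch formula (tree theorem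
`ratMinusTwistedSymbolSum_mul_minusPeriod_mul_I`) gives `(∑ (a/p)[a/p]⁻_f) · Ω⁻_f · i = τ(χ_p) · L(E,1)`
(the coefficients of `E` being those of `f ⊗ χ_p`), `τ(χ_p)² = −p` (Mathlib `gaussSum_sq`, `χ_p` odd),
and Pal 2012 Thm. 3.2 for `d = −p < 0`, PROVED in the tree (`realPeriodRat_mul_sqrt_of_twist_of_neg`),
gives `Ω_E · √p = |u| · c_∞(E) · |Ω⁻(V)|`; so `L(E,1) = (i√p/τ) · ϖ⁻ · (∑ …) · Ω_E/(|u| c_∞)` with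
`i√p/τ = ±1`. No named fact besides modularity (`hmod`). -/
theorem entireLFunction_one_eq_of_twist_neg (hmod : hasEntireLFunction_rat) (hp4 : p % 4 = 3)
    (V W : WeierstrassCurve ℚ) [V.IsElliptic] [V.IsGloballyMinimal] [W.IsElliptic]
    [W.IsGloballyMinimal] (C : VariableChange ℚ) (hC : C • V.quadraticTwist (-(p : ℚ)) = W)
    (hadd : Addv W p) {N : ℕ} [NeZero N] {f : CuspForm (Gamma0 N) 2} (hf : IsNewformOf V f)
    (ϖ : ℚ) (hϖ : (ϖ : ℝ) * V.imaginaryPeriodRat = minusPeriod f) :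
    ∃ ε : ℚ, (ε = 1 ∨ ε = -1) ∧
      W.entireLFunction 1 =
        ((ε * (ϖ * legendreMinusSymbolSum f p) /
            (|(C.u : ℚ)| * ((W.baseChange ℝ).numRealComponents : ℚ)) : ℚ) : ℂ) *
          (W.realPeriodRat : ℂ) := by
  haveI : NeZero p := ⟨hp.out.ne_zero⟩
  have hp2 : p ≠ 2 := by omega
  obtain ⟨hχ1, hχq, hχprim⟩ := jacobiChar_prime_ne_one_isQuadratic_isPrimitive p hp2
  have hχo := jacobiChar_odd_of_mod_four_eq_three p hp4
  set χ := jacobiChar p with hχdef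
  have hE : W.HasEntireLFunction := hmod W
  -- [F]: the Dirichlet coefficients of `W` are those of `f ⊗ χ`
  have hco : ∀ n : ℕ, ((W.LFunction n : ℤ) : ℂ) = χ n * cuspCoeff f n :=
    fun n ↦ intCast_LFunction_eq_jacobiChar_mul_cuspCoeff_of_neg p hp4 V W ⟨C, hC⟩ hadd hf n
  have hL' : ∀ s : ℂ, 2 < s.re → W.entireLFunction s = twistedLSeries f χ⁻¹ s := by
    intro s hs
    rw [hχq.inv, W.entireLFunction_eq_LSeries hE (by linarith), LSeries_eq_twistedLSeries_of_coeff W f χ hco]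
  -- odd Birch
  have hB := ratMinusTwistedSymbolSum_mul_minusPeriod_mul_I f hf.1 hf.coeffField_eq_bot hχprim hχo
    (W.differentiable_entireLFunction hE) hL'
  rw [← cast_legendreMinusSymbolSum_eq_ratMinusTwistedSymbolSum p f] at hB
  -- `τ(χ)² = −p`
  set τ : ℂ := gaussSum χ (ZMod.stdAddChar (N := p)) with hτdef
  have hτsq : τ ^ 2 = -(p : ℂ) := by
    rw [hτdef, gaussSum_sq hχ1 hχq (ZMod.isPrimitive_stdAddChar p), hχo, ZMod.card]
    ring
  -- Pal (d = −p < 0), proved in the tree; `ϖ |Ω⁻_V| = Ω⁻_f`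
  have hpal := V.realPeriodRat_mul_sqrt_of_twist_of_neg (d := -(p : ℚ))
    (neg_lt_zero.mpr (by exact_mod_cast hp.out.pos)) W C hC
  have hsq : Real.sqrt (-((-(p : ℚ) : ℚ) : ℝ)) = Real.sqrt p := by push_cast; rw [neg_neg]
  rw [hsq] at hpal
  set s : ℝ := Real.sqrt p with hs
  set ua : ℝ := |((C.u : ℚ) : ℝ)| with hua
  set c : ℕ := (W.baseChange ℝ).numRealComponents with hc
  have hs0 : s ≠ 0 := Real.sqrt_ne_zero'.mpr (by exact_mod_cast hp.out.pos)
  have hsC : ((s : ℝ) : ℂ) ^ 2 = (p : ℂ) := by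
    rw [← Complex.ofReal_pow, hs, Real.sq_sqrt (Nat.cast_nonneg p)]
    push_cast
    rfl
  have hua0 : ua ≠ 0 := by
    rw [hua]
    exact abs_ne_zero.mpr (by exact_mod_cast C.u.ne_zero)
  have hc0 : (c : ℝ) ≠ 0 := by
    rw [hc, numRealComponents]
    split_ifs <;> norm_num
  have hΩV : V.imaginaryPeriodRat = W.realPeriodRat * s / (ua * c) := by
    rw [eq_div_iff (mul_ne_zero hua0 hc0), hpal]
    ring
  -- in `ℂ`: `S ϖ Ω⁻_V i = τ L`, with `Ω⁻_f = ϖ Ω⁻_V`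
  have hper : (minusPeriod f : ℂ) = (ϖ : ℂ) * (V.imaginaryPeriodRat : ℂ) := by
    rw [← Complex.ofReal_ratCast, ← hϖ]
    push_cast
    ring
  rw [hper] at hB
  -- `τ = ± i s`
  have hτpm : τ = Complex.I * (s : ℂ) ∨ τ = -(Complex.I * (s : ℂ)) := by
    have h0 : (τ + Complex.I * (s : ℂ)) * (τ - Complex.I * (s : ℂ)) = 0 := by
      have hI : (Complex.I * (s : ℂ)) ^ 2 = -(p : ℂ) := by
        rw [mul_pow, Complex.I_sq, hsC]
        ring
      rw [← sq_sub_sq, hτsq, hI, sub_self]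
    rcases mul_eq_zero.mp h0 with h | h
    · exact Or.inr (eq_neg_of_add_eq_zero_left h)
    · exact Or.inl (sub_eq_zero.mp h)
  -- the rational value
  have hsC0 : ((s : ℝ) : ℂ) ≠ 0 := by exact_mod_cast hs0
  have huaC0 : ((ua : ℝ) : ℂ) ≠ 0 := by exact_mod_cast hua0
  have hcC0 : ((c : ℕ) : ℂ) ≠ 0 := by exact_mod_cast (show (c : ℝ) ≠ 0 from hc0)
  have hΩVC : (V.imaginaryPeriodRat : ℂ) = (W.realPeriodRat : ℂ) * (s : ℂ) / ((ua : ℂ) * (c : ℂ)) := by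
    rw [hΩV]
    push_cast
    ring
  have huacast : ((|(C.u : ℚ)| * (c : ℚ) : ℚ) : ℂ) = (ua : ℂ) * (c : ℂ) := by
    rw [hua, Rat.cast_mul, ← Complex.ofReal_ratCast, Rat.cast_abs]
    push_cast
    ring
  rcases hτpm with h | h
  · refine ⟨1, Or.inl rfl, ?_⟩
    rw [h, hΩVC] at hB
    have key : W.entireLFunction 1 * ((ua : ℂ) * (c : ℂ)) =
        (legendreMinusSymbolSum f p : ℂ) * (ϖ : ℂ) * (W.realPeriodRat : ℂ) := by
      have h1 := hB
      field_simp at h1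
      linear_combination -h1
    rw [Rat.cast_div, huacast, div_mul_eq_mul_div, eq_div_iff (mul_ne_zero huaC0 hcC0)]
    push_cast
    linear_combination key
  · refine ⟨-1, Or.inr rfl, ?_⟩
    rw [h, hΩVC] at hB
    have key : W.entireLFunction 1 * ((ua : ℂ) * (c : ℂ)) =
        -((legendreMinusSymbolSum f p : ℂ) * (ϖ : ℂ) * (W.realPeriodRat : ℂ)) := by
      have h1 := hB
      field_simp at h1
      linear_combination h1
    rw [Rat.cast_div, huacast, div_mul_eq_mul_div, eq_div_iff (mul_ne_zero huaC0 hcC0)]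
    push_cast
    linear_combination key

end AnalyticOdd

end Summit.BirchSwinnertonDyer.Rank1Residual.Additive

end
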